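import Summits.HubbardSuperconductivity.HubbardSuperconductivity.Theorems.SoloBlindSpectralWindow
import HarnessLib

/-!
# The robust window is at most `K(c)|t|` wide

Composition of `SoloBlindSpectralWindow` (uniform d-wave order on the low-energy spectral window of
width `ε` gives a certificate with multiplier `κ = (400L⁴ + cL⁴/2)/ε`) with the multiplier lower
bound `multiplier_mul_twistEnergy_ge` of `SoloBlindCertificateForm` (twisted ground states force
`(c/4)L⁴ ≤ κ · 8π²|t|(M²+M)`): if the robust target `R1⁺(ε, cL⁴)` holds in a sector of the Hubbard
torus at a large side, then `ε ≤ 8π²|t|(M²+M)(1600+2c)/c`, `M = ⌊1600/c⌋+1`, uniformly in the side,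
in `U` and in the sector — the spectral counterpart of the gap ceiling `SoloBlindGapCeiling`
(same constant). So the window on which uniform superconducting order can hold is `O(|t|)`
wide, independently of the volume, exactly as the twisted states of
`SoloBlindOrderNotEnergyRobust` demand.

References: `SoloBlindSpectralWindow`, `SoloBlindCertificateForm`, `SoloBlindGapCeiling`
[this work].
-/

namespace Summit.HubbardSuperconductivity.HubbardSuperconductivity.Theorems

open Matrix Finset Literature.Probability.LatticeModels
  Literature.MathematicalPhysics.QuantumLattice Literature.MathematicalPhysics.QuantumFieldTheory
  GaugeTwist
open scoped ComplexConjugate ComplexOrder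

/-- **The robust window cannot be wider than `K(c)|t|`.** Hubbard torus, any `t, U`, sector
`S = szSector N Mz` containing a ground state, side `n + 1 ≥ ⌊1600/c⌋ + 4`, `c > 0`, `ε > 0`. If
`c(n+1)⁴‖w‖² ≤ re⟨w, (√2Δ_d)†(√2Δ_d) w⟩` holds on every `H`-invariant `W ≤ S` with Rayleigh
quotients `≤ E₀ + ε` (the robust target `R1⁺(ε, cL⁴)` of `SoloBlindSpectralWindow`), then
`ε ≤ 8π²|t|(M²+M)(1600+2c)/c`, `M = ⌊1600/c⌋ + 1` — uniformly in the side, `U`, `N`. (The window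
certificate `κ = (400L⁴ + cL⁴/2)/ε` fed into `multiplier_mul_twistEnergy_ge`.) [this work] -/
theorem window_le_of_dWave_window_order {t U c ε : ℝ} (hc : 0 < c) (hε : 0 < ε) {n : ℕ}
    (hn : ⌊1600 / c⌋₊ + 4 ≤ n + 1) {N : ℕ} {Mz : ℝ} {ψ : Fock (Orb (FermionTorus 2 (n + 1)))}
    (hψ : IsGroundStateInSector (hubbardTorus 2 (n + 1) t U) N Mz ψ)
    (hwin : ∀ W : Submodule ℂ (Fock (Orb (FermionTorus 2 (n + 1)))),
      W ≤ szSector (Λ := FermionTorus 2 (n + 1)) N Mz →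
      (∀ w ∈ W, hubbardTorus 2 (n + 1) t U *ᵥ w ∈ W) →
      (∀ w ∈ W, (star w ⬝ᵥ (hubbardTorus 2 (n + 1) t U *ᵥ w)).re ≤
        ((hubbardTorus 2 (n + 1) t U).minEnergyOn (szSector N Mz) + ε) * (star w ⬝ᵥ w).re) →
      ∀ w ∈ W, c * ((n + 1 : ℕ) : ℝ) ^ 4 * (star w ⬝ᵥ w).re ≤
        (star (pairField dWaveFormFactor (n + 1) *ᵥ w) ⬝ᵥ
          (pairField dWaveFormFactor (n + 1) *ᵥ w)).re) :
    ε ≤ 8 * Real.pi ^ 2 * |t| * (((⌊1600 / c⌋₊ + 1 : ℕ) : ℝ) ^ 2 + (⌊1600 / c⌋₊ + 1 : ℕ)) *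
      ((1600 + 2 * c) / c) := by
  classical
  have hP : (0 : ℝ) < ((n + 1 : ℕ) : ℝ) ^ 4 := by positivity
  -- the window certificate: constant `(c/2)L⁴`, multiplier `κ = (400L⁴ + cL⁴/2)/ε`
  have hcert := certificate_of_dWave_window_order (L := n + 1) t U ε (c * ((n + 1 : ℕ) : ℝ) ^ 4)
    hε (by positivity) dWaveFormFactor GaugeTwist.abs_dWaveFormFactor_le_one N Mz hwin
  have hκ0 : (0 : ℝ) ≤ (400 * ((n + 1 : ℕ) : ℝ) ^ 4 + c * ((n + 1 : ℕ) : ℝ) ^ 4 / 2) / ε := by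
    positivity
  have hfl : (800 : ℝ) / (c / 2) = 1600 / c := by
    rw [div_div_eq_mul_div]; norm_num
  have hn' : ⌊800 / (c / 2)⌋₊ + 4 ≤ n + 1 := by rw [hfl]; exact hn
  -- the multiplier lower bound of `SoloBlindCertificateForm` with constant `c/2`
  have hmult := multiplier_mul_twistEnergy_ge (t := t) (U := U) (half_pos hc) hn' hψ hκ0 (by
    intro φ hφ hφ1
    have h := hcert φ hφ
    rw [hφ1, Complex.one_re, ← PosSemidefTrace.expect_conjTranspose_mul] at h
    simp only [mul_one] at h
    linarith)
  rw [hfl] at hmult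
  set e : ℝ := 8 * Real.pi ^ 2 * |t| *
    (((⌊1600 / c⌋₊ + 1 : ℕ) : ℝ) ^ 2 + (⌊1600 / c⌋₊ + 1 : ℕ)) with he
  have he0 : 0 ≤ e := by positivity
  -- `(c/4)L⁴ ≤ κ e`, i.e. `(c/4)L⁴ ε ≤ (400 + c/2)L⁴ e`
  have h2 : c / 2 / 2 * ((n + 1 : ℕ) : ℝ) ^ 4 * ε ≤
      (400 * ((n + 1 : ℕ) : ℝ) ^ 4 + c * ((n + 1 : ℕ) : ℝ) ^ 4 / 2) * e := by
    have hXe : (400 * ((n + 1 : ℕ) : ℝ) ^ 4 + c * ((n + 1 : ℕ) : ℝ) ^ 4 / 2) / ε * e =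
        (400 * ((n + 1 : ℕ) : ℝ) ^ 4 + c * ((n + 1 : ℕ) : ℝ) ^ 4 / 2) * e / ε := by ring
    have := hmult
    rw [hXe, le_div_iff₀ hε] at this
    exact this
  rw [← mul_div_assoc, le_div_iff₀ hc]
  nlinarith [h2, hP]

end Summit.HubbardSuperconductivity.HubbardSuperconductivity.Theorems
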